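import Summits.BirchSwinnertonDyer.BirchSwinnertonDyer.Theorems.ManinLocalTwoThreeDatumModelChange
import Summits.BirchSwinnertonDyer.BirchSwinnertonDyer.Theorems.ManinLocalTwoThreeManinOddAtFourOfKatoFact
import Summits.BirchSwinnertonDyer.BirchSwinnertonDyer.Theorems.ManinLocalTwoThreeFormalKummerDoubling
import Summits.BirchSwinnertonDyer.Rank1Residual.ManinAdditive.CuspidalKummerClass
import Summits.BirchSwinnertonDyer.Rank1Residual.ManinAdditive.KatoShiftTwoLaws
import Literature.NumberTheory.EllipticCurves.OpenImageMazurAssemblyProofs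
import HarnessLib

/-!
# The reducible residual of C2 BY NAME from the cuspidal-Kummer programme:
# `ManinOddOfReducibleAtFour ⟸ E-an-48 ∧ E-an-53 ∧ E-an-52 ∧ E-an-50`, hence
# `ManinOddAtFour ⟸ F♯ ∧ E-an-48 ∧ E-an-53 ∧ E-an-52 ∧ E-an-50`

Summit `BirchSwinnertonDyer`, route `ManinLocalTwoThree` (cell bsd-f2-manin), deciding crux C2 `ManinOddAtFour`
(stmt-BirchSwinnertonDyer-22967), line `kato_shift_two` (lead p1).  Skeleton v9 reduced C2 kernel-exactly to Kato's F♯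
(`kato_neron_isIntegral_twistedSymbolSum_of_additive_two_real`, Literature, statement-only) and the `W[2]`-REDUCIBLE
residual `Rb`.  The an planner's MEMO-an §56 gives a `c`-free mechanism for `Rb`, typed as the tree leaf
`Summits/BirchSwinnertonDyer/Rank1Residual/ManinAdditive/CuspidalKummerClass.lean`:

* E-an-48 `CuspidalKummerRepresentativeAtFour` (crux K_geo, generalized-Ogg type: `ι(T) = φ^*[(T) − (O)]` is a rational
  cuspidal class, `η`-representable) — OPEN;
* E-an-53 `CuspidalKummerOddExponent` (a non-blind `T` has an odd `η`-exponent; equivalently `ι(T) ∉ Σ(N)`) — OPEN,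
  C2-equivalent on its locus;
* E-an-52 `ManinOddOfOddEtaExponent` (the certificate; = E-an-47 ∧ E-an-49⁺ ∧ UFD, both conjuncts PROVED in the tree:
  `EvenManinKummerSquare_holds` (p2), `EtaUnitSquareIffEven_holds` (p3)) — theorem-grade;
* E-an-50 `KummerBlindResidualOdd` (the totally Kummer-blind curves; 20 / 2311 classes with `N ≤ 5000`) — OPEN residual.

THIS FILE proves the composition BY NAME (`maninOddOfReducibleAtFour_of_cuspidalKummer`):
`E-an-48 → E-an-53 → E-an-52 → E-an-50 → ManinOddOfReducibleAtFour`, and hence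
(`maninOddAtFour_of_katoFact_of_cuspidalKummer`, through the lead's `maninOddAtFour_of_katoFact_of_reducible`)
`F♯ → E-an-48 → E-an-53 → E-an-52 → E-an-50 → ManinOddAtFour`.  The glue is the lead's model-change file
(`ManinLocalTwoThreeDatumModelChange`): `4 ∣ N ⇒ a₂(f) = 0 ∧ 2 ∣ N_W ⇒` additive at `2` (p2) `⇒` integral `u = 1` change
to a globally minimal `a₁ = a₃ = 0` equation `C • W`, along which the datum `D` transports with the same `c`, newform and
lattice clause; `W[2]` reducible `⇒` an INTEGER root `e` of the `2`-division cubic of `C • W`; the formal germ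
`z = exp_{E_{C•W,c}}(Σ aₙqⁿ/n)` exists (`IsParamGerm`); then either some integral root is NOT Kummer-blind — K_geo gives a
cuspidal representative, E-an-53 an odd exponent, E-an-52 `2 ∤ c` — or every integral root is blind — E-an-50.

HONEST FRAMING: a CONDITIONAL reduction; E-an-48, E-an-53, E-an-50 (and F♯) are open; nothing about BSD or about Manin's
conjecture is proved here, and no actual Manin constant's parity is decided.
-/

set_option autoImplicit false
set_option linter.dupNamespace false

noncomputable section

open scoped Classical MatrixGroups ModularForm
open PowerSeries CongruenceSubgroup IsDedekindDomain NumberField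
open WeierstrassCurve Literature.NumberTheory.EllipticCurves Literature.NumberTheory.EllipticCurves.ModularForms
  Literature.RingTheory.FormalGroups
open Summit.BirchSwinnertonDyer.Rank1Residual.ManinAdditive
open Summit.BirchSwinnertonDyer.Rank1Residual.ManinAdditive.CuspidalKummer

namespace Summit.BirchSwinnertonDyer.BirchSwinnertonDyer.Theorems.ManinLocalTwoThree

/-- The formal germ of the parametrisation exists: `z := exp_{E_{W,c}}(Σ aₙqⁿ/n)` satisfies `IsParamGerm W c a z`
(`log ∘ exp = id` on `qℚ⟦q⟧`). [folklore] -/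
theorem exists_isParamGerm (W : WeierstrassCurve ℚ) (c : ℤ) (a : ℕ → ℤ) : ∃ z : ℚ⟦X⟧, IsParamGerm W c a z := by
  have hL0 : constantCoeff (lSeriesLog a) = 0 := by
    simp [lSeriesLog, PowerSeries.constantCoeff_mk]
  refine ⟨(shortModel W c).formalExp.subst (lSeriesLog a), ?_, ?_⟩
  · rw [Literature.RingTheory.FormalGroups.constantCoeff_subst_of_constantCoeff_eq_zero hL0,
      constantCoeff_formalExp]
  · exact formalLog_subst_formalExp_subst _ hL0

/-- **The reducible residual of C2 from the cuspidal-Kummer programme, BY NAME**: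
`CuspidalKummerRepresentativeAtFour → CuspidalKummerOddExponent → ManinOddOfOddEtaExponent → KummerBlindResidualOdd →
ManinOddOfReducibleAtFour`.  CONDITIONAL reduction (the first, second and fourth hypotheses are open `@[conjecture]`
leaves of the cell). [folklore] -/
theorem maninOddOfReducibleAtFour_of_cuspidalKummer
    (h48 : CuspidalKummerRepresentativeAtFour) (h53 : CuspidalKummerOddExponent)
    (h52 : ManinOddOfOddEtaExponent) (h50 : KummerBlindResidualOdd) : ManinOddOfReducibleAtFour := by
  intro W _ _ N _ D hopt h4 hred
  have h4' : 4 ∣ N := by norm_num at h4; exact h4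
  -- additive reduction at `2`
  obtain ⟨h2, hN2⟩ := lFunction_two_eq_zero_of_four_dvd W D.isNewformOf h4'
  have hadd := hasAdditiveReductionAt_two_of_lFunction_two_eq_zero W h2 hN2
  -- the `a₁ = a₃ = 0` companion and the transported datum
  obtain ⟨C, M, hu, hCW, hM1, hM3, hmin⟩ := exists_smul_eq_map_a₁_a₃_eq_zero_of_hasAdditiveReductionAt_two W hadd
  haveI := hmin
  obtain ⟨D', hf, hc, hL, -⟩ := exists_modularParametrizationData_smul_of_u_eq_one W D C hu
  have hopt' : ∀ z ∈ D'.L.lattice, ∃ w ∈ periodLattice D'.f, z = D'.c * w := by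
    rw [hL, hf, hc]; exact hopt
  have ha₁ : (C • W).a₁ = 0 := by rw [hCW, map_a₁, hM1, map_zero]
  have ha₃ : (C • W).a₃ = 0 := by rw [hCW, map_a₃, hM3, map_zero]
  have ha₂ : (C • W).a₂ = (M.a₂ : ℚ) := by rw [hCW, map_a₂, eq_intCast]
  have ha₄ : (C • W).a₄ = (M.a₄ : ℚ) := by rw [hCW, map_a₄, eq_intCast]
  -- an integral `2`-torsion abscissa
  have hred' : ¬ (C • W).HasIrreducibleModPGaloisRep 2 := by
    rwa [Mazur1978.hasIrreducibleModPGaloisRep_smul_iff]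
  obtain ⟨e, he⟩ := exists_isRoot_twoTorsionPolynomial_of_not_hasIrreducibleModPGaloisRep_two (C • W) hred'
  have heM : (M.map (Int.castRingHom ℚ)).twoTorsionPolynomial.toPoly.IsRoot e := hCW ▸ he
  obtain ⟨e₀, rfl⟩ := exists_intCast_eq_of_isRoot_twoTorsionPolynomial M hM1 hM3 heM
  -- integer newform coefficients and the formal germ of `E_{C • W, c}`
  set a : ℕ → ℤ := fun n => (C • W).LFunction n with ha_def
  have ha : ∀ n, (a n : ℂ) = cuspCoeff D'.f n := fun n => (D'.isNewformOf.2 n).symm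
  obtain ⟨z, hz⟩ := exists_isParamGerm (C • W) D'.c a
  -- dichotomy: some integral root is not Kummer-blind, or all are blind
  by_cases hnb : ∃ e₁ : ℤ, (C • W).twoTorsionPolynomial.toPoly.IsRoot (e₁ : ℚ) ∧ ¬ KummerBlindAtTwo M.a₂ M.a₄ e₁
  · obtain ⟨e₁, he₁, hnb₁⟩ := hnb
    obtain ⟨r, g, A, B, hrep⟩ := h48 (C • W) D' a ha h4' hopt' (e₁ : ℚ) he₁ z hz
    have hodd : ∃ δ ∈ N.divisors, Odd (r δ) :=
      h53 (C • W) D' a ha h4' hopt' M.a₂ M.a₄ e₁ ha₁ ha₃ ha₂ ha₄ he₁ hnb₁ z hz r g A B hrep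
    have h := h52 (C • W) D' a ha h4' (e₁ : ℚ) he₁ z hz r g A B hrep hodd
    rwa [hc] at h
  · push Not at hnb
    have h := h50 (C • W) D' hopt' h4' M.a₂ M.a₄ ha₁ ha₃ ha₂ ha₄ ⟨e₀, he⟩ hnb
    change ¬ (2 : ℤ) ∣ D'.c at h
    rwa [hc] at h

/-- **C2 `ManinOddAtFour` BY NAME from Kato's F♯ and the four cuspidal-Kummer rows** (E-an-48, E-an-53, E-an-52, E-an-50),
through the lead's `maninOddAtFour_of_katoFact_of_reducible`.  CONDITIONAL: F♯ is a statement-only Literature reading of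
Kato (Astérisque 295, Thm. 6.6 (1), 9.7, 12.5) and three of the four rows are open cell conjectures; nothing about BSD
or Manin's conjecture is proved. [cite: Kato2004Asterisque, Thm. 9.7 (p. 189)] -/
theorem maninOddAtFour_of_katoFact_of_cuspidalKummer
    (hF : kato_neron_isIntegral_twistedSymbolSum_of_additive_two_real)
    (h48 : CuspidalKummerRepresentativeAtFour) (h53 : CuspidalKummerOddExponent)
    (h52 : ManinOddOfOddEtaExponent) (h50 : KummerBlindResidualOdd) :
    Summit.BirchSwinnertonDyer.BirchSwinnertonDyer.Theses.ManinLocalTwoThree.ManinOddAtFour :=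
  maninOddAtFour_of_katoFact_of_reducible hF (maninOddOfReducibleAtFour_of_cuspidalKummer h48 h53 h52 h50)

/-! ### The ORBIT-MINIMAL, TOTALLY KUMMER-BLIND residual (skeleton v10's open stub) and its edges -/

/-- **The v9 residual `Rb` (verbatim) from K_geo, E-an-53, E-an-52 and the ORBIT-MINIMAL TOTALLY-BLIND residual.**
The last hypothesis is skeleton v10's stub `stub_blindOrbitMinimalResidual`: the v9 twist-orbit-minimality clauses
verbatim, PLUS the `a₁ = a₃ = 0` normal form `C • W = M` (`u = 1`) presented as data, an integral `2`-torsion abscissa,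
and EVERY integral `2`-torsion abscissa Kummer-blind (`KummerBlindAtTwo`); in Cremona's range these are the 55 tame IV*
classes at `N = 4(m² + 4)` and `32a1, 128b1, 128d1` (an §56.5/§58; the 31 wild `16(m²+4)` members are `χ₋₁`-twists of
the tame ones and are excluded by the third clause).  CONDITIONAL reduction; nothing about BSD or Manin's conjecture is
proved. [folklore] -/
theorem orbitMinimalReducibleResidual_of_cuspidalKummer_of_blindOrbitMinimal
    (h48 : CuspidalKummerRepresentativeAtFour) (h53 : CuspidalKummerOddExponent)
    (h52 : ManinOddOfOddEtaExponent)
    (hB :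
    ∀ (W : WeierstrassCurve ℚ) [W.IsElliptic] [W.IsGloballyMinimal] {N : ℕ} [NeZero N]
      (D : ModularParametrizationData W N),
      (∀ z ∈ D.L.lattice, ∃ w ∈ periodLattice D.f, z = D.c * w) → 2 ^ 2 ∣ N →
      ¬ (∃ (W' : WeierstrassCurve ℚ) (d : ℤ), W'.IsElliptic ∧ W'.IsGloballyMinimal ∧
        (d = -1 ∨ d = 2 ∨ d = -2) ∧ IsIsogenous W (W'.quadraticTwist (d : ℚ)) ∧
        ¬ 2 ^ 2 ∣ W'.conductorNorm ℤ) →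
      ¬ (∃ (W' : WeierstrassCurve ℚ) (q : ℕ), W'.IsElliptic ∧ W'.IsGloballyMinimal ∧
        q.Prime ∧ q ≠ 2 ∧ q ^ 2 ∣ N ∧
        IsIsogenous W (W'.quadraticTwist (((-1 : ℤ) ^ (q / 2) * q : ℤ) : ℚ)) ∧
        ¬ q ^ 2 ∣ W'.conductorNorm ℤ) →
      ¬ (∃ (A : WeierstrassCurve ℚ), A.IsElliptic ∧ A.IsGloballyMinimal ∧ 2 ^ 4 ∣ N ∧
        2 ^ 2 ∣ A.conductorNorm ℤ ∧ A.conductorNorm ℤ ∣ N ∧ A.conductorNorm ℤ < N ∧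
        IsIsogenous W (A.quadraticTwist ((-1 : ℤ) : ℚ))) →
      ¬ (∃ (A : WeierstrassCurve ℚ) (_ : A.IsElliptic) (_ : A.IsGloballyMinimal) (N' : ℕ) (_ : NeZero N')
        (D' : ModularParametrizationData A N') (d : ℤ) (C : WeierstrassCurve ℚ) (u : VariableChange ℚ),
        C.IsElliptic ∧ C.IsGloballyMinimal ∧
        (∀ z ∈ D'.L.lattice, ∃ w ∈ periodLattice D'.f, z = D'.c * w) ∧ (d = 2 ∨ d = -2) ∧ 2 ^ 6 ∣ N ∧
        2 ^ 2 ∣ A.conductorNorm ℤ ∧ A.conductorNorm ℤ ∣ N ∧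
        IsIsogenous W (A.quadraticTwist (d : ℚ)) ∧ u • A.quadraticTwist (d : ℚ) = C ∧
        C.Δ = (d : ℚ) ^ 6 * A.Δ ∧
        (A.conductorNorm ℤ < N ∨ A.minimalDiscriminantInt.natAbs < W.minimalDiscriminantInt.natAbs)) →
      ¬ (∃ (A : WeierstrassCurve ℚ) (_ : A.IsElliptic) (_ : A.IsGloballyMinimal)
        (D' : ModularParametrizationData A N) (q : ℕ) (C : WeierstrassCurve ℚ) (u : VariableChange ℚ),
        C.IsElliptic ∧ C.IsGloballyMinimal ∧
        (∀ z ∈ D'.L.lattice, ∃ w ∈ periodLattice D'.f, z = D'.c * w) ∧ q.Prime ∧ q ≠ 2 ∧ q ^ 2 ∣ N ∧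
        IsIsogenous C W ∧ u • A.quadraticTwist (((-1 : ℤ) ^ (q / 2) * q : ℤ) : ℚ) = C ∧
        C.Δ = ((((-1 : ℤ) ^ (q / 2) * q : ℤ)) : ℚ) ^ 6 * A.Δ ∧
        A.minimalDiscriminantInt.natAbs < W.minimalDiscriminantInt.natAbs) →
      ∀ (C : VariableChange ℚ) (M : WeierstrassCurve ℤ), C.u = 1 → C • W = M.map (Int.castRingHom ℚ) →
        M.a₁ = 0 → M.a₃ = 0 → (C • W).IsGloballyMinimal →
        (∃ e : ℤ, (C • W).twoTorsionPolynomial.toPoly.IsRoot (e : ℚ)) →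
        (∀ e : ℤ, (C • W).twoTorsionPolynomial.toPoly.IsRoot (e : ℚ) → KummerBlindAtTwo M.a₂ M.a₄ e) →
        ¬ (2 : ℤ) ∣ D.c) :
    ∀ (W : WeierstrassCurve ℚ) [W.IsElliptic] [W.IsGloballyMinimal] {N : ℕ} [NeZero N]
      (D : ModularParametrizationData W N),
      (∀ z ∈ D.L.lattice, ∃ w ∈ periodLattice D.f, z = D.c * w) → 2 ^ 2 ∣ N →
      ¬ (∃ (W' : WeierstrassCurve ℚ) (d : ℤ), W'.IsElliptic ∧ W'.IsGloballyMinimal ∧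
        (d = -1 ∨ d = 2 ∨ d = -2) ∧ IsIsogenous W (W'.quadraticTwist (d : ℚ)) ∧
        ¬ 2 ^ 2 ∣ W'.conductorNorm ℤ) →
      ¬ (∃ (W' : WeierstrassCurve ℚ) (q : ℕ), W'.IsElliptic ∧ W'.IsGloballyMinimal ∧
        q.Prime ∧ q ≠ 2 ∧ q ^ 2 ∣ N ∧
        IsIsogenous W (W'.quadraticTwist (((-1 : ℤ) ^ (q / 2) * q : ℤ) : ℚ)) ∧
        ¬ q ^ 2 ∣ W'.conductorNorm ℤ) →
      ¬ (∃ (A : WeierstrassCurve ℚ), A.IsElliptic ∧ A.IsGloballyMinimal ∧ 2 ^ 4 ∣ N ∧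
        2 ^ 2 ∣ A.conductorNorm ℤ ∧ A.conductorNorm ℤ ∣ N ∧ A.conductorNorm ℤ < N ∧
        IsIsogenous W (A.quadraticTwist ((-1 : ℤ) : ℚ))) →
      ¬ (∃ (A : WeierstrassCurve ℚ) (_ : A.IsElliptic) (_ : A.IsGloballyMinimal) (N' : ℕ) (_ : NeZero N')
        (D' : ModularParametrizationData A N') (d : ℤ) (C : WeierstrassCurve ℚ) (u : VariableChange ℚ),
        C.IsElliptic ∧ C.IsGloballyMinimal ∧
        (∀ z ∈ D'.L.lattice, ∃ w ∈ periodLattice D'.f, z = D'.c * w) ∧ (d = 2 ∨ d = -2) ∧ 2 ^ 6 ∣ N ∧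
        2 ^ 2 ∣ A.conductorNorm ℤ ∧ A.conductorNorm ℤ ∣ N ∧
        IsIsogenous W (A.quadraticTwist (d : ℚ)) ∧ u • A.quadraticTwist (d : ℚ) = C ∧
        C.Δ = (d : ℚ) ^ 6 * A.Δ ∧
        (A.conductorNorm ℤ < N ∨ A.minimalDiscriminantInt.natAbs < W.minimalDiscriminantInt.natAbs)) →
      ¬ (∃ (A : WeierstrassCurve ℚ) (_ : A.IsElliptic) (_ : A.IsGloballyMinimal)
        (D' : ModularParametrizationData A N) (q : ℕ) (C : WeierstrassCurve ℚ) (u : VariableChange ℚ),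
        C.IsElliptic ∧ C.IsGloballyMinimal ∧
        (∀ z ∈ D'.L.lattice, ∃ w ∈ periodLattice D'.f, z = D'.c * w) ∧ q.Prime ∧ q ≠ 2 ∧ q ^ 2 ∣ N ∧
        IsIsogenous C W ∧ u • A.quadraticTwist (((-1 : ℤ) ^ (q / 2) * q : ℤ) : ℚ) = C ∧
        C.Δ = ((((-1 : ℤ) ^ (q / 2) * q : ℤ)) : ℚ) ^ 6 * A.Δ ∧
        A.minimalDiscriminantInt.natAbs < W.minimalDiscriminantInt.natAbs) →
      ¬ W.HasIrreducibleModPGaloisRep 2 → ¬ (2 : ℤ) ∣ D.c := by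
  intro W _ _ N _ D hopt h4 hc1 hc2 hc3 hc4 hc5 hred
  have h4' : 4 ∣ N := by norm_num at h4; exact h4
  obtain ⟨h2, hN2⟩ := lFunction_two_eq_zero_of_four_dvd W D.isNewformOf h4'
  have hadd := hasAdditiveReductionAt_two_of_lFunction_two_eq_zero W h2 hN2
  obtain ⟨C, M, hu, hCW, hM1, hM3, hmin⟩ := exists_smul_eq_map_a₁_a₃_eq_zero_of_hasAdditiveReductionAt_two W hadd
  haveI := hmin
  obtain ⟨D', hf, hc, hL, -⟩ := exists_modularParametrizationData_smul_of_u_eq_one W D C hu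
  have hopt' : ∀ z ∈ D'.L.lattice, ∃ w ∈ periodLattice D'.f, z = D'.c * w := by
    rw [hL, hf, hc]; exact hopt
  have ha₁ : (C • W).a₁ = 0 := by rw [hCW, map_a₁, hM1, map_zero]
  have ha₃ : (C • W).a₃ = 0 := by rw [hCW, map_a₃, hM3, map_zero]
  have ha₂ : (C • W).a₂ = (M.a₂ : ℚ) := by rw [hCW, map_a₂, eq_intCast]
  have ha₄ : (C • W).a₄ = (M.a₄ : ℚ) := by rw [hCW, map_a₄, eq_intCast]
  have hred' : ¬ (C • W).HasIrreducibleModPGaloisRep 2 := by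
    rwa [Mazur1978.hasIrreducibleModPGaloisRep_smul_iff]
  obtain ⟨e, he⟩ := exists_isRoot_twoTorsionPolynomial_of_not_hasIrreducibleModPGaloisRep_two (C • W) hred'
  have heM : (M.map (Int.castRingHom ℚ)).twoTorsionPolynomial.toPoly.IsRoot e := hCW ▸ he
  obtain ⟨e₀, rfl⟩ := exists_intCast_eq_of_isRoot_twoTorsionPolynomial M hM1 hM3 heM
  set a : ℕ → ℤ := fun n => (C • W).LFunction n with ha_def
  have ha : ∀ n, (a n : ℂ) = cuspCoeff D'.f n := fun n => (D'.isNewformOf.2 n).symm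
  obtain ⟨z, hz⟩ := exists_isParamGerm (C • W) D'.c a
  by_cases hnb : ∃ e₁ : ℤ, (C • W).twoTorsionPolynomial.toPoly.IsRoot (e₁ : ℚ) ∧ ¬ KummerBlindAtTwo M.a₂ M.a₄ e₁
  · obtain ⟨e₁, he₁, hnb₁⟩ := hnb
    obtain ⟨r, g, A, B, hrep⟩ := h48 (C • W) D' a ha h4' hopt' (e₁ : ℚ) he₁ z hz
    have hodd : ∃ δ ∈ N.divisors, Odd (r δ) :=
      h53 (C • W) D' a ha h4' hopt' M.a₂ M.a₄ e₁ ha₁ ha₃ ha₂ ha₄ he₁ hnb₁ z hz r g A B hrep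
    have h := h52 (C • W) D' a ha h4' (e₁ : ℚ) he₁ z hz r g A B hrep hodd
    rwa [hc] at h
  · push Not at hnb
    exact hB W D hopt h4 hc1 hc2 hc3 hc4 hc5 C M hu hCW hM1 hM3 hmin ⟨e₀, he⟩ hnb

/-- **EDGE: an's E-an-50 `KummerBlindResidualOdd` implies skeleton v10's orbit-minimal totally-blind stub** (drop the
orbit-minimality clauses; transport the datum to the normal form `C • W` along `u = 1`). [folklore] -/
theorem blindOrbitMinimalResidual_of_kummerBlindResidualOdd (h50 : KummerBlindResidualOdd) :
    ∀ (W : WeierstrassCurve ℚ) [W.IsElliptic] [W.IsGloballyMinimal] {N : ℕ} [NeZero N]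
      (D : ModularParametrizationData W N),
      (∀ z ∈ D.L.lattice, ∃ w ∈ periodLattice D.f, z = D.c * w) → 2 ^ 2 ∣ N →
      ¬ (∃ (W' : WeierstrassCurve ℚ) (d : ℤ), W'.IsElliptic ∧ W'.IsGloballyMinimal ∧
        (d = -1 ∨ d = 2 ∨ d = -2) ∧ IsIsogenous W (W'.quadraticTwist (d : ℚ)) ∧
        ¬ 2 ^ 2 ∣ W'.conductorNorm ℤ) →
      ¬ (∃ (W' : WeierstrassCurve ℚ) (q : ℕ), W'.IsElliptic ∧ W'.IsGloballyMinimal ∧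
        q.Prime ∧ q ≠ 2 ∧ q ^ 2 ∣ N ∧
        IsIsogenous W (W'.quadraticTwist (((-1 : ℤ) ^ (q / 2) * q : ℤ) : ℚ)) ∧
        ¬ q ^ 2 ∣ W'.conductorNorm ℤ) →
      ¬ (∃ (A : WeierstrassCurve ℚ), A.IsElliptic ∧ A.IsGloballyMinimal ∧ 2 ^ 4 ∣ N ∧
        2 ^ 2 ∣ A.conductorNorm ℤ ∧ A.conductorNorm ℤ ∣ N ∧ A.conductorNorm ℤ < N ∧
        IsIsogenous W (A.quadraticTwist ((-1 : ℤ) : ℚ))) →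
      ¬ (∃ (A : WeierstrassCurve ℚ) (_ : A.IsElliptic) (_ : A.IsGloballyMinimal) (N' : ℕ) (_ : NeZero N')
        (D' : ModularParametrizationData A N') (d : ℤ) (C : WeierstrassCurve ℚ) (u : VariableChange ℚ),
        C.IsElliptic ∧ C.IsGloballyMinimal ∧
        (∀ z ∈ D'.L.lattice, ∃ w ∈ periodLattice D'.f, z = D'.c * w) ∧ (d = 2 ∨ d = -2) ∧ 2 ^ 6 ∣ N ∧
        2 ^ 2 ∣ A.conductorNorm ℤ ∧ A.conductorNorm ℤ ∣ N ∧
        IsIsogenous W (A.quadraticTwist (d : ℚ)) ∧ u • A.quadraticTwist (d : ℚ) = C ∧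
        C.Δ = (d : ℚ) ^ 6 * A.Δ ∧
        (A.conductorNorm ℤ < N ∨ A.minimalDiscriminantInt.natAbs < W.minimalDiscriminantInt.natAbs)) →
      ¬ (∃ (A : WeierstrassCurve ℚ) (_ : A.IsElliptic) (_ : A.IsGloballyMinimal)
        (D' : ModularParametrizationData A N) (q : ℕ) (C : WeierstrassCurve ℚ) (u : VariableChange ℚ),
        C.IsElliptic ∧ C.IsGloballyMinimal ∧
        (∀ z ∈ D'.L.lattice, ∃ w ∈ periodLattice D'.f, z = D'.c * w) ∧ q.Prime ∧ q ≠ 2 ∧ q ^ 2 ∣ N ∧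
        IsIsogenous C W ∧ u • A.quadraticTwist (((-1 : ℤ) ^ (q / 2) * q : ℤ) : ℚ) = C ∧
        C.Δ = ((((-1 : ℤ) ^ (q / 2) * q : ℤ)) : ℚ) ^ 6 * A.Δ ∧
        A.minimalDiscriminantInt.natAbs < W.minimalDiscriminantInt.natAbs) →
      ∀ (C : VariableChange ℚ) (M : WeierstrassCurve ℤ), C.u = 1 → C • W = M.map (Int.castRingHom ℚ) →
        M.a₁ = 0 → M.a₃ = 0 → (C • W).IsGloballyMinimal →
        (∃ e : ℤ, (C • W).twoTorsionPolynomial.toPoly.IsRoot (e : ℚ)) →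
        (∀ e : ℤ, (C • W).twoTorsionPolynomial.toPoly.IsRoot (e : ℚ) → KummerBlindAtTwo M.a₂ M.a₄ e) →
        ¬ (2 : ℤ) ∣ D.c := by
  intro W _ _ N _ D hopt h4 _ _ _ _ _ C M hu hCW hM1 hM3 hmin hex hall
  have h4' : 4 ∣ N := by norm_num at h4; exact h4
  haveI := hmin
  obtain ⟨D', hf, hc, hL, -⟩ := exists_modularParametrizationData_smul_of_u_eq_one W D C hu
  have hopt' : ∀ z ∈ D'.L.lattice, ∃ w ∈ periodLattice D'.f, z = D'.c * w := by
    rw [hL, hf, hc]; exact hopt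
  have ha₁ : (C • W).a₁ = 0 := by rw [hCW, map_a₁, hM1, map_zero]
  have ha₃ : (C • W).a₃ = 0 := by rw [hCW, map_a₃, hM3, map_zero]
  have ha₂ : (C • W).a₂ = (M.a₂ : ℚ) := by rw [hCW, map_a₂, eq_intCast]
  have ha₄ : (C • W).a₄ = (M.a₄ : ℚ) := by rw [hCW, map_a₄, eq_intCast]
  have h := h50 (C • W) D' hopt' h4' M.a₂ M.a₄ ha₁ ha₃ ha₂ ha₄ hex hall
  change ¬ (2 : ℤ) ∣ D'.c at h
  rwa [hc] at h


/-- **C2 `ManinOddAtFour` BY NAME from Kato's F♯, K_geo (E-an-48), E-an-53, the certificate E-an-52 and the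
ORBIT-MINIMAL TOTALLY-BLIND residual** — skeleton v10 of line `kato_shift_two`, through the lead's gen-3
`maninOddAtFour_of_katoFact_of_orbitMinimalResidual`.  CONDITIONAL (F♯ statement-only; E-an-48, E-an-53 and the blind
residual open); nothing about BSD or Manin's conjecture is proved. [cite: Kato2004Asterisque, Thm. 9.7 (p. 189)] -/
theorem maninOddAtFour_of_katoFact_of_cuspidalKummer_of_blindOrbitMinimal
    (hF : kato_neron_isIntegral_twistedSymbolSum_of_additive_two_real)
    (h48 : CuspidalKummerRepresentativeAtFour) (h53 : CuspidalKummerOddExponent)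
    (h52 : ManinOddOfOddEtaExponent)
    (hB :
    ∀ (W : WeierstrassCurve ℚ) [W.IsElliptic] [W.IsGloballyMinimal] {N : ℕ} [NeZero N]
      (D : ModularParametrizationData W N),
      (∀ z ∈ D.L.lattice, ∃ w ∈ periodLattice D.f, z = D.c * w) → 2 ^ 2 ∣ N →
      ¬ (∃ (W' : WeierstrassCurve ℚ) (d : ℤ), W'.IsElliptic ∧ W'.IsGloballyMinimal ∧
        (d = -1 ∨ d = 2 ∨ d = -2) ∧ IsIsogenous W (W'.quadraticTwist (d : ℚ)) ∧
        ¬ 2 ^ 2 ∣ W'.conductorNorm ℤ) →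
      ¬ (∃ (W' : WeierstrassCurve ℚ) (q : ℕ), W'.IsElliptic ∧ W'.IsGloballyMinimal ∧
        q.Prime ∧ q ≠ 2 ∧ q ^ 2 ∣ N ∧
        IsIsogenous W (W'.quadraticTwist (((-1 : ℤ) ^ (q / 2) * q : ℤ) : ℚ)) ∧
        ¬ q ^ 2 ∣ W'.conductorNorm ℤ) →
      ¬ (∃ (A : WeierstrassCurve ℚ), A.IsElliptic ∧ A.IsGloballyMinimal ∧ 2 ^ 4 ∣ N ∧
        2 ^ 2 ∣ A.conductorNorm ℤ ∧ A.conductorNorm ℤ ∣ N ∧ A.conductorNorm ℤ < N ∧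
        IsIsogenous W (A.quadraticTwist ((-1 : ℤ) : ℚ))) →
      ¬ (∃ (A : WeierstrassCurve ℚ) (_ : A.IsElliptic) (_ : A.IsGloballyMinimal) (N' : ℕ) (_ : NeZero N')
        (D' : ModularParametrizationData A N') (d : ℤ) (C : WeierstrassCurve ℚ) (u : VariableChange ℚ),
        C.IsElliptic ∧ C.IsGloballyMinimal ∧
        (∀ z ∈ D'.L.lattice, ∃ w ∈ periodLattice D'.f, z = D'.c * w) ∧ (d = 2 ∨ d = -2) ∧ 2 ^ 6 ∣ N ∧
        2 ^ 2 ∣ A.conductorNorm ℤ ∧ A.conductorNorm ℤ ∣ N ∧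
        IsIsogenous W (A.quadraticTwist (d : ℚ)) ∧ u • A.quadraticTwist (d : ℚ) = C ∧
        C.Δ = (d : ℚ) ^ 6 * A.Δ ∧
        (A.conductorNorm ℤ < N ∨ A.minimalDiscriminantInt.natAbs < W.minimalDiscriminantInt.natAbs)) →
      ¬ (∃ (A : WeierstrassCurve ℚ) (_ : A.IsElliptic) (_ : A.IsGloballyMinimal)
        (D' : ModularParametrizationData A N) (q : ℕ) (C : WeierstrassCurve ℚ) (u : VariableChange ℚ),
        C.IsElliptic ∧ C.IsGloballyMinimal ∧
        (∀ z ∈ D'.L.lattice, ∃ w ∈ periodLattice D'.f, z = D'.c * w) ∧ q.Prime ∧ q ≠ 2 ∧ q ^ 2 ∣ N ∧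
        IsIsogenous C W ∧ u • A.quadraticTwist (((-1 : ℤ) ^ (q / 2) * q : ℤ) : ℚ) = C ∧
        C.Δ = ((((-1 : ℤ) ^ (q / 2) * q : ℤ)) : ℚ) ^ 6 * A.Δ ∧
        A.minimalDiscriminantInt.natAbs < W.minimalDiscriminantInt.natAbs) →
      ∀ (C : VariableChange ℚ) (M : WeierstrassCurve ℤ), C.u = 1 → C • W = M.map (Int.castRingHom ℚ) →
        M.a₁ = 0 → M.a₃ = 0 → (C • W).IsGloballyMinimal →
        (∃ e : ℤ, (C • W).twoTorsionPolynomial.toPoly.IsRoot (e : ℚ)) →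
        (∀ e : ℤ, (C • W).twoTorsionPolynomial.toPoly.IsRoot (e : ℚ) → KummerBlindAtTwo M.a₂ M.a₄ e) →
        ¬ (2 : ℤ) ∣ D.c) :
    Summit.BirchSwinnertonDyer.BirchSwinnertonDyer.Theses.ManinLocalTwoThree.ManinOddAtFour :=
  maninOddAtFour_of_katoFact_of_orbitMinimalResidual hF
    (orbitMinimalReducibleResidual_of_cuspidalKummer_of_blindOrbitMinimal h48 h53 h52 hB)

end Summit.BirchSwinnertonDyer.BirchSwinnertonDyer.Theorems.ManinLocalTwoThree

end
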